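import Mathlib
import HarnessLib
import Summits.NavierStokesRegularity.NavierStokesRegularity.Theses.PoloidalWindowDoor
import Summits.NavierStokesRegularity.NavierStokesRegularity.Theorems.PoloidalWindowDoorLrcModEntireFarThreadReduction
import Summits.NavierStokesRegularity.NavierStokesRegularity.Theorems.PoloidalWindowDoorLrcModEntireFarThreadSplit
import Summits.NavierStokesRegularity.NavierStokesRegularity.Theorems.LoopPeriodRatchetNoPlanarExtremum
import Summits.NavierStokesRegularity.NavierStokesRegularity.Theorems.LoopPeriodRatchetNoLoopsOfGrowth
import Summits.NavierStokesRegularity.NavierStokesRegularity.Theorems.LoopPeriodRatchetPeriodScalingBound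
import Summits.NavierStokesRegularity.NavierStokesRegularity.Theorems.PoloidalWindowDoorPoloidalWindowRigidityLoopTangencyPin
import Summits.NavierStokesRegularity.NavierStokesRegularity.Theorems.PoloidalWindowDoorPoloidalWindowRigidityThreadZeroStructure

/-!
**v5 (hygiene, critic P12-1, 2026-08-28T19:4xZ): P1 `stub_loopTangencyPin` and Z1 `stub_threadZeroStructure` are now DISCHARGED BY NAME from the landed
Theorems modules `…PoloidalWindowDoorPoloidalWindowRigidityLoopTangencyPin` (p658484) and `…ThreadZeroStructure` (K2-p2 g11); statements UNCHANGED; sorries 7 → 5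
(S0, I1, I3, S6G, Z3).  No summit is proved by any line.**
# SKELETON `centre_type` v4 — crux `PoloidalWindowRigidity` (K2, stmt-NavierStokesRegularity-19708; concludes ALSO the promoted item
# `LrcModEntire`, stmt-NavierStokesRegularity-20428), route `PoloidalWindowDoor`, THICK column AT AN ISOLATED THREAD — ideator seat ns-idea-8
# gen 6, line 1 (= LINE 12 of the seat; lens «barrier» = barrier-inversion; files-only per KEY-NS #68/#69: NOT the skeleton of record; the K2
# leads decide adoption).  No summit is proved by any line.

LEVER (five words): **type the thread's vorticity zero.**

v4 UPGRADE (2026-08-28T19:3xZ): THE CENTRE CELL IS CLOSED MODULO THE NAMED WALL, BY KERNEL COMPOSITION THROUGH PROVED ITEMS.  At a centre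
(`det Hessₕσ(−1,0) = det(H − M) > 0`) the Clebsch stream function `ψ = v₂ − ∂_zΦ` has a NON-DEGENERATE, hence STRICT, planar extremum at the
thread (`∇ₕψ(0) = ∇ₕv₂(0) − ∂_z vₕ(0) = 0` by the pins, `Hessₕψ(0) = H − M` definite) — Z1 part (C), provable (second-order sufficient
condition; `Φ` from tree `…Clebsch.exists_clebsch_slice`).  The PROVED route item `LoopPeriodRatchet.NoPlanarExtremum` (tree
`…LoopPeriodRatchetNoPlanarExtremum.noPlanarExtremum_proof`, p-landed) says: in a class poloidal profile WITHOUT non-stationary closed vortex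
lines, `ψ` has no strict planar extremum anywhere; and `…LoopPeriodRatchetNoLoopsOfGrowth.noLoopsOfGrowth_proof` (PROVED) turns the wall item
S6G `LoopPeriodRatchet.FrequencyGrowthExponent` (stmt 27893, OPEN — the named wall of thread_axis v8–v10 / LoopPeriodRatchet) plus the PROVED
`LoopPeriodRatchet.PeriodScalingBound` (`…periodScalingBound_proof`) into exactly that no-loops hypothesis.  Hence v3's deciding research stub
Z2 `stub_centreThreadEmpty` is now the THEOREM `centreThreadEmpty_of_growth` (kernel-checked below, from Z1 + S6G + tree), and the line's stub
set is: provable {P1, Z1(A,B,C), I1}, shared wall {S6G, by name}, shared research {S0}, residues {Z3 line-jet thread, I3 hot arc} — 7 stubs.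
Relative to thread_axis v10.2 (whose chain to S6G needs a MORSE hot spot, S7′, and leaves the flat hot spots as residue S3′): no Morse
hypothesis on `w` at all — `σ` is Morse whenever the vorticity zero is non-degenerate, which covers every flat top over a definite shear; the
residue shrinks from «flat hot spot» to «line-jet thread» (rank `(H − M) ≤ 1`).

BARRIER INVERTED.  The THICK column at the threaded hot spot is I2 = `stub_isolatedThreadEmpty` (isolated_thread v1), cut by `thread_type`
(g5) by the SLOPE on balls (REG/ELL/SING).  Two technique classes are recorded void or walled there: (i) FINITE JETS at `(−1,0)` read as an
unstructured polynomial system (PINSHEET-g10 / THREAD-CENSUS-g10 / THREAD-PIN-ERRATUM: at the isolated-thread pin the scheme is non-generic,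
decider open), (ii) LEAF-MOMENT systems in the leaf coordinate `w = v₂` (wall S6G; and the structure function `G(t,z,w)`, `φ_z = G`, is
SINGULAR at every flat top or hot arc, `G_w → ±∞` — thread_type's residue C3).  The statement just outside both is obtained by CHANGING THE LEAF
COORDINATE.  In the poloidal class `vₕ = ∇ₕφ` and the CLEBSCH STREAM FUNCTION `σ := v₂ − ∂_zφ` has `ω = curl v = (∂₁σ, −∂₀σ, 0)`: `σ` is a
second, GLOBAL first integral of the vortex lines on every horizontal plane, smooth where `G` is not, and the whole THICK normal form is regular
in `σ`-currency (`w = F(t,z,σ)` with `F_σ = 1/(1−Λ)`, slope `Λ = 1 − 1/F_σ`; frozen law ⇔ `∇ₕw ∥ ∇ₕσ`; pressure potential `ℋ = ½w² − 𝔉(σ)`,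
`𝔉_σ = F`; `G_w = ±∞` ⇔ `F_σ = 0`, a regular value).  An isolated thread is a ZERO OF VORTICITY (loop-tangency pin P1: `∂_z vₕ(−1,0) = 0`, with
`∇v₂(−1,0) = 0`), i.e. a critical point of BOTH leaf functions `w` and `σ`, and its TYPE is the type of that zero: the linearisation of the
planar field `ωₕ(−1,·,0) = J∇ₕσ` at `0` is `J·Hessₕσ(0)` with `Hessₕσ(0) = H − M`, where `H_ab := ∂_b∂_a v₂(−1,0)` (Hessian of `w`) and
`M_ab := ∂_b∂_z v_a(−1,0)` (horizontal Jacobian of the vertical shear; SYMMETRIC since `ω₂ ≡ 0`, trace `−∂_z²v₂(−1,0)` since `∂_z div v = 0`).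
FIRST (provable) STRUCTURE: the frozen law `∂_z v₀·∂₁v₂ − ∂_z v₁·∂₀v₂ ≡ 0`, all four factors vanishing at the thread, has quadratic Taylor
coefficient `det[M y, H y] ≡ 0` — `M y ∥ H y` for every horizontal `y` — and two real symmetric 2×2 matrices with pointwise-collinear images are
LINEARLY DEPENDENT (`stub_threadZeroStructure`, Z1: `∃ (c₁,c₂) ≠ 0, c₁M = c₂H`; three-case linear algebra).  Hence `H`, `M`, `Hessₕσ = H − M`
are pairwise proportional, and the excluded middle on `det Hessₕσ(0) = det(H − M)` types the thread:
* NO X-POINT (Z1, part B — PROVABLE, planar topology; v3): `det(H − M) < 0` would make the thread a non-degenerate SADDLE of `σ(·,0)`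
  (an X-point of `ωₕ`); but `0` is a STRICT planar extremum of `w(·,0)` (`|v₂| ≤ |N|` + isolation of the critical point, `hiso`) and an
  isolated critical point of `σ(·,0)`, and `{σ, w}ₕ ≡ 0` makes `∇ₕσ = λ∇ₕw` with `λ ≠ 0` of ONE sign on a punctured disc: on the component `U ∋ 0`
  of a super-level set `{w > c}` compactly inside that disc, `σ|Ū` cannot attain its max/min on `∂U ⊂ {w = c}` on the side where `λ∇w` points
  into `U`, nor at an interior point `≠ 0` (`∇σ ≠ 0`), so `σ(·,0)` has a local EXTREMUM at `0` and `Hessₕσ(0) = H − M` is semi-definite: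
  `det(H − M) ≥ 0`.  (v1/v2 erratum: v1 cut on `det ≠ 0 | = 0` and called `det ≠ 0` a centre; v2 moved `det < 0` into the residue; v3 KILLS it.)
* VORTEX CENTRE (`det(H − M) > 0` ⇔, given Z1, `H − M` NEGATIVE DEFINITE for `N > 0`): `σ(−1,·,0)` is MORSE DEFINITE at the thread, the near-top
  vortex loops of I2 are the `σ`-circles of a non-degenerate centre with finite non-zero linear frequency `Ω₀ = √det(H − M)`, `F(t,z,·)` is
  ANALYTIC at `σ₀` (Morse lemma + analyticity of the slice), and the cell contains BOTH the Morse tops (`det H ≠ 0`, `M = μH`, `μ = lim Λ ≤ 0` —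
  thread_type's C2 core; elliptic Morse tops die by 2-jet algebra, `∂_z²v₂ = −μ·Δₕv₂ ≤ 0`) AND the FLAT tops over a DEFINITE shear (`H = 0`, `M > 0`:
  thread_type's singular-slope object C3, `Λ → −∞`, now `F_σ(σ₀) = 0`, `w − N = −c(σ₀ − σ)^k + …`, a REGULAR configuration in `σ`-currency).
  v4: this cell is the THEOREM `centreThreadEmpty_of_growth` modulo the shared wall stub S6G `stub_frequencyGrowthExponent`
  (= `LoopPeriodRatchet.FrequencyGrowthExponent`, item 27893, VERBATIM by name): Z1(C) strict planar extremum of `ψ` → PROVED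
  `NoPlanarExtremum` → contradiction with the no-loops consequence of S6G + PROVED `PeriodScalingBound` (`noLoopsOfGrowth_proof`).  The wall is
  MET BY NAME, not claimed.
* LINE-JET THREAD (`det(H − M) = 0`): by Z1 and the sign pins of the maximum (`H ≤ 0`, `tr M = −∂_z²v₂ ≥ 0`, so `M = H` forces `H = 0`),
  `H`, `M` and `H − M` are all multiples of ONE rank-one tensor `f⊗f` (or all zero): the 2-jet of `(∇ₕv₂, ∂_z vₕ, ωₕ)` at the thread is
  INVARIANT UNDER TRANSLATION ALONG `f^⊥` — to second order the thread is a LINE OF HOT SPOTS, i.e. infinitesimally stratum (A) (whose thick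
  twisting members STRATUM-A-K2p4 THEOREM A-THICK excludes: the named neighbour theorem; an anisotropic blow-up along `f^⊥` is the candidate
  transfer — NOT claimed).  `stub_lineJetThreadEmpty` (Z3, residue on a NEW typed object: the line-jet thread; it contains thread_type's
  parabolic tops and the totally flat 2-jet).  Part B's argument adds on this cell: EITHER zeros of `ωₕ(−1,·,0)` (points with `Λ = 1`) accumulate
  at the thread, OR `σ(·,0)` has an isolated DEGENERATE local extremum at `0` (recorded for the prover; not a stub).
SHARED VERBATIM: S0 `stub_localTHEmptyHypNUGRS` ((TH) column, twist_split v4.3/v5, decider j301374), I1 `stub_threadCurveSelection`, I3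
`stub_hotArcEmpty` (isolated_thread v1 b7fc49e2120c), P1 `stub_loopTangencyPin` (thread_type v2 11c84e268a90; K2 hands landing, P11-1).

COMPOSITION (kernel-checked, no sorry outside `stub_*`): `centreThreadEmpty_of_growth` (v3's Z2 signature, from Z1(C) + S6G + tree
`noPlanarExtremum_proof` ∘ `noLoopsOfGrowth_proof` ∘ `periodScalingBound_proof`), `isolatedThreadEmpty_of_centreType` (I2 VERBATIM from P1, Z1,
that theorem and Z3 by trichotomy on `det(H − M)`: `< 0` impossible by Z1 part B, `> 0` the theorem, `= 0` Z3), `threadedThickEmpty_of_centreType` (S3 VERBATIM, via I1/I3), `LrcModEntire_of_centreType :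
…Theses.PoloidalWindowDoor.LrcModEntire` (tree p633507 `lrcModEntire_of_NUGRS_of_threadedThick`) and `PoloidalWindowRigidity_of_centreType :
…Theses.PoloidalWindowDoor.PoloidalWindowRigidity` (tree `poloidalWindowRigidity_of_TH_of_threadedThick` ∘ the v4.3 local chain).  7 stubs.

RELATION TO thread_type (same seat, g5): thread_type cuts I2 by the slope on BALLS (REG/ELL/SING) and leaves the singular-slope thread C3 as an
untyped residue; centre_type cuts AT THE POINT by the vorticity zero, moves the non-degenerate flat tops (the bulk of C3) into the deciding cell
where the period machinery applies in `σ`-currency, proves the elliptic-Morse exclusion algebraically (Z1 + trace pin, no maximum principle),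
and isolates the one configuration invisible to both cuts so far — the line-jet thread — as a typed object with a named neighbour theorem.
Neither line implies the other stub-wise; C1 (thread_type) and Z1 (here) are the provable stubs of each.

CHEAPEST FALSIFIER.  (1) Z1 against the registry's exact jets: every exact isolated-thread jet of cert-1's census at pin threadI
(THREAD-PIN-ERRATUM-idea8g5, HOME lines/census/) must satisfy `det[M y, H y] ≡ 0`, `M = Mᵀ`, `tr M = −∂_z²v₂` — a free consistency check of
the census ideal (it contains the frozen law) and of Z1's typing; ONE violating exact jet kills Z1 as typed (index conventions are the
realistic risk: cert-1 pins `G[i][j] = ∂_j v_i`).  (2) TYPE SUB-CENSUSES (instrument rows for the K2 hands, same engine): at pin threadI add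
the LINE-JET rows (`H`, `M` ∝ `f⊗f`; in the rotation gauge `f = e₀`: `H₀₁ = H₁₁ = 0`, `M₀₁ = M₁₁ = 0` — 4 equations, no new letter) → the Z3
sub-scheme; EMPTY at low order closes the residue at jet level and leaves I2 = Z2 (the centre) exactly; conversely the generic point of the
threadI scheme lies in Z2, so the pending threadI decider («expected-empty order 14u») IS the jet-level decider of Z2.  (3) Kinematic germs
(K-48: Cauchy–Kovalevskaya for `w_zz + Δₕ[G] = 0`, or directly in `σ`-currency) realise every centre type — Z2/Z3 are class-level (dynamic)
statements; a kinematic example is not a refutation, a CLASS member is.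

WHAT THIS IS NOT: not a proof of Navier–Stokes regularity, of K2, of item 20428, of S3 or of I2 — a typed re-cut of I2 AT THE POINT with ONE
provable stub (Z1, M), the named wall S6G as a shared stub BY NAME (item 27893; the centre cell is a theorem modulo it) and ONE residue on a
new typed object (Z3), plus four shared stubs (S0, I1, I3, P1).  (M) and the Type-I class are kept in every class-level stub (honours `Negative.poloidalWindowRigidity_false_without_mild`,
K-47, K-48/K-50).  Technique that generated the line: barrier-inversion of the leaf-coordinate singularity (Clebsch stream function `σ` as second
leaf coordinate) + the frozen law read as a tensor identity at a double zero.  bears_on LADDER-NS N0 (rung N0-LocalTubeDoorPoloidal), items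
19708 / 20428.  No summit is proved by any line.
-/

noncomputable section

set_option linter.dupNamespace false
set_option linter.unusedVariables false

namespace Summit.NavierStokesRegularity.NavierStokesRegularity.Cruxes.PoloidalWindowRigidity.CentreType

open MeasureTheory Set Function Filter Topology Metric
open scoped RealInnerProductSpace InnerProductSpace Laplacian
open Literature.Analysis Literature.Analysis.FluidPDE
open Summit.NavierStokesRegularity.NavierStokesRegularity.Theses.PoloidalWindowDoor
open Summit.NavierStokesRegularity.NavierStokesRegularity.Theorems.PoloidalWindowDoorLrcModEntireTwistingTHLocalHypGerm
open Summit.NavierStokesRegularity.NavierStokesRegularity.Theorems.PoloidalWindowDoorLrcModEntireTwistingTHLocalNonUmbilic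
open Summit.NavierStokesRegularity.NavierStokesRegularity.Theorems.PoloidalWindowDoorLrcModEntireTwistingTHLocalGalilean
open Summit.NavierStokesRegularity.NavierStokesRegularity.Theorems.PoloidalWindowDoorLrcModEntireTwistingTHLocalNormalFormRS
open Summit.NavierStokesRegularity.NavierStokesRegularity.Theorems.PoloidalWindowDoorLrcModEntireFarThreadReduction

/-! ## Shared stubs (verbatim) -/

/-- **SHARED STUB ((TH) column) — VERBATIM `stub_localTHEmptyHypNUGRS` of the skeleton of record `Cruxes/LrcModEntire/Lines/twist_split.lean`
v4.3/v5 (ns-poloidal-K2-p3; item stmt-NavierStokesRegularity-20428; decider j301374).**  The local hyperbolic (TH)∩twisting PDE system is empty at a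
non-umbilic rest point in the rotation/scaling gauge.  One landing closes it here and there. -/
theorem stub_localTHEmptyHypNUGRS :
    ∀ (u : ℝ → EuclideanSpace ℝ (Fin 3) → EuclideanSpace ℝ (Fin 3)) (μ A : ℝ → ℝ → ℝ)
      (U : Set (ℝ × EuclideanSpace ℝ (Fin 3))) (p₀ : ℝ × EuclideanSpace ℝ (Fin 3)),
      IsOpen U → p₀ ∈ U →
      AnalyticOnNhd ℝ (Function.uncurry u) U →
      (∀ p ∈ U, AnalyticAt ℝ (Function.uncurry μ) (p.1, p.2 2)) →
      (∀ p ∈ U, AnalyticAt ℝ (Function.uncurry A) (p.1, p.2 2)) →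
      (∀ p ∈ U, fderiv ℝ (u p.1) p.2 (EuclideanSpace.single 0 1) 1 = fderiv ℝ (u p.1) p.2 (EuclideanSpace.single 1 1) 0) →
      (∀ p ∈ U, fderiv ℝ (u p.1) p.2 (EuclideanSpace.single 0 1) 0 + fderiv ℝ (u p.1) p.2 (EuclideanSpace.single 1 1) 1 +
        fderiv ℝ (u p.1) p.2 (EuclideanSpace.single 2 1) 2 = 0) →
      (∀ p ∈ U, ∀ b : Fin 3, b ≠ 2 →
        fderiv ℝ (u p.1) p.2 (EuclideanSpace.single 2 1) b =
          μ p.1 (p.2 2) * fderiv ℝ (u p.1) p.2 (EuclideanSpace.single b 1) 2) →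
      (∀ p ∈ U,
        (1 - μ p.1 (p.2 2)) *
            (deriv (fun s => u s p.2 2) p.1 + fderiv ℝ (fun y => u p.1 y 2) p.2 (u p.1 p.2)
              - Δ (fun y => u p.1 y 2) p.2) =
          A p.1 (p.2 2) + (deriv (fun s => μ s (p.2 2)) p.1 - deriv (deriv (μ p.1)) (p.2 2)) * u p.1 p.2 2
            + deriv (μ p.1) (p.2 2) / 2 * u p.1 p.2 2 ^ 2
            - 2 * deriv (μ p.1) (p.2 2) * fderiv ℝ (u p.1) p.2 (EuclideanSpace.single 2 1) 2) →
      fderiv ℝ (fun y => fderiv ℝ (u p₀.1) y (EuclideanSpace.single 2 1) 2) p₀.2 (EuclideanSpace.single 0 1) *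
            fderiv ℝ (u p₀.1) p₀.2 (EuclideanSpace.single 1 1) 2 -
          fderiv ℝ (fun y => fderiv ℝ (u p₀.1) y (EuclideanSpace.single 2 1) 2) p₀.2 (EuclideanSpace.single 1 1) *
            fderiv ℝ (u p₀.1) p₀.2 (EuclideanSpace.single 0 1) 2 ≠ 0 →
      μ p₀.1 (p₀.2 2) ≠ 0 → μ p₀.1 (p₀.2 2) ≠ 1 → deriv (μ p₀.1) (p₀.2 2) ≠ 0 →
      μ p₀.1 (p₀.2 2) < 0 →
      (fderiv ℝ (u p₀.1) p₀.2 (EuclideanSpace.single 0 1) 0 ≠ fderiv ℝ (u p₀.1) p₀.2 (EuclideanSpace.single 1 1) 1 ∨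
        fderiv ℝ (u p₀.1) p₀.2 (EuclideanSpace.single 1 1) 0 ≠ 0) →
      u p₀.1 p₀.2 = 0 → 
      fderiv ℝ (u p₀.1) p₀.2 (EuclideanSpace.single 0 1) 2 = 0 →
      fderiv ℝ (u p₀.1) p₀.2 (EuclideanSpace.single 1 1) 2 = 1 → False := by
  sorry

/-- **STUB I1 (provable, M): CURVE SELECTION AT THE HOT SPOT.**  For a poloidal class profile whose scale-invariant vertical size
`√(−t)|v₂|` attains its supremum at `(−1,0)`, the planar restriction `f(y₀,y₁) := v₂(−1,(y₀,y₁,0))` is real-analytic (Type-I ancient mild ⇒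
space-analytic slices: KNSS derivative bounds `‖∇ᵏv(s)‖∞ ≤ C_k C^{k+1}(−s)^{−(1+k)/2}` with factorial control, crux workfile `TypeIAnalytic.lean`) and
has a global maximum of `|f|` at `0`.  EITHER `0` is an isolated point of the critical set of `f` (first disjunct: no horizontal critical point in a
punctured planar disc), OR it is not, and then the CURVE SELECTION LEMMA for the real-analytic set `Crit(f) = {∂₀f = ∂₁f = 0}` (Milnor 1968 §3,
Lemma 3.1; Łojasiewicz 1965 §18) gives a continuous injective half-arc `γ : [0,∞) → Crit(f)`, `γ(0) = 0`, real-analytic in a Puiseux parameter, along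
which `(f∘γ)' = ⟪∇f(γ), γ'⟫ = 0`, so `f∘γ ≡ f(0)`: an arc of top-level points (second disjunct).  Why it might fail: only through the analyticity
input (the stub is false for `C^∞` profiles: flat bumps); Mathlib has no curve selection lemma (L-sized to formalise; M on paper). -/
theorem stub_threadCurveSelection :
    ∀ (C : ℝ) (v : ℝ → EuclideanSpace ℝ (Fin 3) → EuclideanSpace ℝ (Fin 3)),
      Literature.Analysis.FluidPDE.HasTypeITimeDecay C v →
      ContinuousOn (Function.uncurry v) (Set.Iio (0 : ℝ) ×ˢ Set.univ) →
      (∀ s t : ℝ, s < t → t < 0 → ∀ x, v t x =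
        Literature.Analysis.UnboundedOperators.heatExtension (v s) (t - s) x -
          Literature.Analysis.FluidPDE.oseenDuhamel 1 s v v t x) →
      (∀ t < 0, Literature.Analysis.FluidPDE.VectorCalculus.IsDivFree (v t)) →
      (∀ s < 0, ∀ y, ⟪Literature.Analysis.FluidPDE.curl (v s) y, EuclideanSpace.single 2 1⟫_ℝ = 0) →
      v (-1) 0 2 ≠ 0 → (∀ t < 0, ∀ x, Real.sqrt (-t) * |v t x 2| ≤ |v (-1) 0 2|) →
      (∃ δ : ℝ, 0 < δ ∧ ∀ y : EuclideanSpace ℝ (Fin 3), y 2 = 0 → y ≠ 0 → ‖y‖ < δ →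
          (fderiv ℝ (v (-1)) y (EuclideanSpace.single 0 1) 2 ≠ 0 ∨ fderiv ℝ (v (-1)) y (EuclideanSpace.single 1 1) 2 ≠ 0)) ∨
      (∃ γ : ℝ → EuclideanSpace ℝ (Fin 3), ContinuousOn γ (Set.Ici 0) ∧ Set.InjOn γ (Set.Ici 0) ∧ γ 0 = 0 ∧
          ∀ σ : ℝ, 0 ≤ σ → (γ σ 2 = 0 ∧ v (-1) (γ σ) 2 = v (-1) 0 2)) := by
  sorry

/-- **STUB I3 (residue on a NEW OBJECT): NO HOT ARC.**  `stub_threadedThickEmpty` VERBATIM plus the second curve-selection alternative: a continuous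
injective half-arc `Γ = γ([0,∞))` in the hot spot's plane, issuing from the hot spot, along which `v₂(−1,·) ≡ v₂(−1,0)` — every point of `Γ` is a
hot spot (all pins of `…ThreadPins`, `…ThreadPressure`, `…ThreadSpaceTimePin` hold along `Γ`).  Structure to use: near `Γ` the leaves are open bands
flanking `Γ` (no closed leaf: the disc-moment engine of `stub_isolatedThreadEmpty` is void here, which is why this is a separate statement); `Γ` is a
horizontal vortex line or a zero of `ω`; in Fermi coordinates `(σ,n)` the flanking twist is `−2a^{3/2}n²∂_σ(b/√a) + O(n³)`, `a = −½D²v₂[ν,ν] ≥ 0`,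
`b = D²v₂[ν,e₂]`, `b² ≤ 2a(−∂_z²v₂)` (signed Hessian pin), so thick twisting windows accumulate at the thread iff `b/√a` is not locally constant
along `Γ`; if `Γ` is unbounded, recentring along it (tree compactness `…ExtremalThread`) keeps an arc of hot spots through the new origin.  The arc
interpolates between the isolated thread and stratum (A) (a full LINE of hot spots; no thick twisting member, STRATUM-A-K2p4 THEOREM A-THICK).
Why it might fail: an arc of simultaneous maxima is infinite-codimension but not excluded by any identity in the tree; a K-48-type kinematic
witness with a line of maxima may exist outside (M) (ask the disprover; (M) kept). -/
theorem stub_hotArcEmpty :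
    ∀ (C : ℝ) (v : ℝ → EuclideanSpace ℝ (Fin 3) → EuclideanSpace ℝ (Fin 3)),
      Literature.Analysis.FluidPDE.HasTypeITimeDecay C v →
      ContinuousOn (Function.uncurry v) (Set.Iio (0 : ℝ) ×ˢ Set.univ) →
      (∀ s t : ℝ, s < t → t < 0 → ∀ x, v t x =
        Literature.Analysis.UnboundedOperators.heatExtension (v s) (t - s) x -
          Literature.Analysis.FluidPDE.oseenDuhamel 1 s v v t x) →
      (∀ t < 0, Literature.Analysis.FluidPDE.VectorCalculus.IsDivFree (v t)) →
      (∀ s < 0, ∀ y, ⟪Literature.Analysis.FluidPDE.curl (v s) y, EuclideanSpace.single 2 1⟫_ℝ = 0) →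
      v (-1) 0 2 ≠ 0 → (∀ t < 0, ∀ x, Real.sqrt (-t) * |v t x 2| ≤ |v (-1) 0 2|) →
      (∀ h : EuclideanSpace ℝ (Fin 3), fderiv ℝ (v (-1)) 0 h 2 = 0) →
      (deriv (fun s => v s 0 2) (-1) = v (-1) 0 2 / 2 ∧ v (-1) 0 2 * (Δ (fun y => v (-1) y 2)) 0 ≤ 0) →
      (∃ γ : ℝ → EuclideanSpace ℝ (Fin 3), ContinuousOn γ (Set.Ici 0) ∧ Set.InjOn γ (Set.Ici 0) ∧ γ 0 = 0 ∧
          ∀ σ : ℝ, 0 ≤ σ → (γ σ 2 = 0 ∧ v (-1) (γ σ) 2 = v (-1) 0 2)) →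
      ∀ W : Set (ℝ × EuclideanSpace ℝ (Fin 3)), IsOpen W → W ⊆ Set.Iio (0 : ℝ) ×ˢ Set.univ →
        (∀ z ∈ W, (Literature.Analysis.FluidPDE.curl (v z.1) z.2 ≠ 0 ∧
            (fderiv ℝ (v z.1) z.2 (EuclideanSpace.single 0 1) 2 ≠ 0 ∨ fderiv ℝ (v z.1) z.2 (EuclideanSpace.single 1 1) 2 ≠ 0) ∧
            (fderiv ℝ (v z.1) z.2 (EuclideanSpace.single 2 1) 0 ≠ 0 ∨ fderiv ℝ (v z.1) z.2 (EuclideanSpace.single 2 1) 1 ≠ 0)) ∧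
          (fderiv ℝ (fun x => fderiv ℝ (v z.1) x (EuclideanSpace.single 2 1) 2) z.2 (EuclideanSpace.single 0 1) *
                fderiv ℝ (v z.1) z.2 (EuclideanSpace.single 1 1) 2 -
              fderiv ℝ (fun x => fderiv ℝ (v z.1) x (EuclideanSpace.single 2 1) 2) z.2 (EuclideanSpace.single 1 1) *
                fderiv ℝ (v z.1) z.2 (EuclideanSpace.single 0 1) 2 ≠ 0)) →
        (∀ m : ℝ → ℝ → ℝ, ∀ W₁ : Set (ℝ × EuclideanSpace ℝ (Fin 3)), W₁ ⊆ W → IsOpen W₁ → W₁.Nonempty →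
            ∃ z ∈ W₁, ∃ b : Fin 3, b ≠ 2 ∧
              fderiv ℝ (v z.1) z.2 (EuclideanSpace.single 2 1) b ≠
                m z.1 (z.2 2) * fderiv ℝ (v z.1) z.2 (EuclideanSpace.single b 1) 2) →
        (∀ r : ℝ, 0 < r → (Metric.ball ((-1 : ℝ), (0 : EuclideanSpace ℝ (Fin 3))) r ∩ W).Nonempty) →
        False := by
  sorry

/-- **SHARED STUB P1 — VERBATIM `stub_loopTangencyPin` of `Lines/thread_type.lean` v2 (provable, S/M; K2 hands landing it, critic price P11-1): LOOP-TANGENCY PIN — the horizontal vorticity vanishes at an isolated thread.**  Class profile, poloidal,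
hot spot at `(−1,0)` (`|v₂| √(−t) ≤ |v₂(−1,0)|`), and the hot spot is an ISOLATED horizontal critical point of `y ↦ v₂(−1,(y₀,y₁,0))` (the first
curve-selection alternative of `stub_threadCurveSelection`).  Then `∂_z v₀(−1,0) = ∂_z v₁(−1,0) = 0` — i.e. `ωₕ(−1,0) = 0`, since `∇v₂(−1,0) = 0`
makes `ωₕ(−1,0) = (−∂_z v₁, ∂_z v₀)(−1,0)`.  PROOF SKETCH: the frozen law `ω·∇v₂ = 0` (e₂-component of the vorticity equation with `ω₂ ≡ 0`; tree
`…ErtelCollapse.poloidal_iff_frozen` / `…FirstIntegral` for class profiles, `…LocalFrozenLaw.stretching_two_eq_zero` for germs) and `ω₂ = 0` say that on the plane `{y₂ = 0}` the planar field `X(y₀,y₁) := ωₕ(−1,(y₀,y₁,0))` satisfies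
`X·∇g = 0` for `g := v₂(−1,(·,·,0))`: `g` is a first integral of `X`.  If `X(0) ≠ 0`, the local integral curve `c` of the `C¹` field `X` through `0`
(Mathlib Picard–Lindelöf, `exists_forall_hasDerivAt_Ioo_eq_of_contDiffAt`) has `g ∘ c ≡ g(0)`, and `g(0) = v₂(−1,0)` is an extremal value of `g`
(`|g| ≤ |g(0)|`), so every `c(τ)` is an extremum, hence a critical point of `g`, distinct from `0` for small `τ ≠ 0` and inside any `δ`-ball —
contradicting isolation.  Size S/M (smoothness of the slice: tree KNSS regularity of the class).  The two equations are NEW PINS for the thread jet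
census (THREAD-CENSUS-g10 seeds with `ωₕ(0) ≠ 0` are hot ARCS, `stub_hotArcEmpty`'s object, never isolated threads). -/
theorem stub_loopTangencyPin :
    ∀ (C : ℝ) (v : ℝ → EuclideanSpace ℝ (Fin 3) → EuclideanSpace ℝ (Fin 3)),
      Literature.Analysis.FluidPDE.HasTypeITimeDecay C v →
      ContinuousOn (Function.uncurry v) (Set.Iio (0 : ℝ) ×ˢ Set.univ) →
      (∀ s t : ℝ, s < t → t < 0 → ∀ x, v t x =
        Literature.Analysis.UnboundedOperators.heatExtension (v s) (t - s) x -
          Literature.Analysis.FluidPDE.oseenDuhamel 1 s v v t x) →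
      (∀ t < 0, Literature.Analysis.FluidPDE.VectorCalculus.IsDivFree (v t)) →
      (∀ s < 0, ∀ y, ⟪Literature.Analysis.FluidPDE.curl (v s) y, EuclideanSpace.single 2 1⟫_ℝ = 0) →
      v (-1) 0 2 ≠ 0 → (∀ t < 0, ∀ x, Real.sqrt (-t) * |v t x 2| ≤ |v (-1) 0 2|) →
      (∃ δ : ℝ, 0 < δ ∧ ∀ y : EuclideanSpace ℝ (Fin 3), y 2 = 0 → y ≠ 0 → ‖y‖ < δ →
          (fderiv ℝ (v (-1)) y (EuclideanSpace.single 0 1) 2 ≠ 0 ∨ fderiv ℝ (v (-1)) y (EuclideanSpace.single 1 1) 2 ≠ 0)) →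
      (fderiv ℝ (v (-1)) 0 (EuclideanSpace.single 2 1) 0 = 0 ∧ fderiv ℝ (v (-1)) 0 (EuclideanSpace.single 2 1) 1 = 0) :=
  Summit.NavierStokesRegularity.NavierStokesRegularity.Theorems.PoloidalWindowDoorPoloidalWindowRigidityLoopTangencyPin.stub_loopTangencyPin

/-! ## Own stubs: the 2-jet tensor structure at the thread and the centre-type cut of I2 -/

/-- **STUB Z1 (PROVABLE; part A S/M 2-jet algebra, part B M planar topology, part C M second-order condition): STRUCTURE OF THE THREAD'S VORTICITY ZERO — SHEAR JACOBIAN AND VELOCITY HESSIAN ARE LINEARLY DEPENDENT, THE ZERO IS NEVER AN X-POINT, AND A CENTRE IS A STRICT PLANAR EXTREMUM OF THE STREAM FUNCTION.**  Class profile, poloidal; at the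
slice `t = −1` the point `0` is a critical point of `v₂` (`∇v₂(−1,0) = 0`, thread pin) and the vertical shear vanishes there (`∂_z vₕ(−1,0) = 0`,
the loop-tangency pin of `stub_loopTangencyPin`).  Conclusion, with `H_ab := ∂_b∂_a v₂(−1,0)` and `M_ab := ∂_b∂_z v_a(−1,0)` (`a, b ∈ {0,1}`):
(i) `M` is symmetric (`∂₁∂_z v₀ = ∂₀∂_z v₁`: `ω₂ = ∂₀v₁ − ∂₁v₀ ≡ 0` differentiated in `z`; holds at every point); (ii) `tr M = −∂_z²v₂(−1,0)`
(`∂_z div v = 0`; every point); (iii) `M` and `H` are linearly dependent: `∃ (c₁,c₂) ≠ 0, c₁M = c₂H`.  PROOF SKETCH of (iii): the frozen law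
`f := ∂_z v₀·∂₁v₂ − ∂_z v₁·∂₀v₂ ≡ 0` on the slice (tree `…ErtelCollapse.poloidal_iff_frozen` / `…FirstIntegral` for class profiles; region form
`…LocalFrozenLaw.vertShear_wedge_horizGrad_eq_zero`); all four factors vanish at `0`, so `D²f(0)[y,y] = 2·det[My, Hy] = 0` for every horizontal
`y` (product rule; the class slice is smooth, tree KNSS regularity / `…Ancient.analyticOnNhd_uncurry`): `My ∥ Hy` pointwise.  LEMMA (linear
algebra, three cases): real symmetric 2×2 `M, H` with `My ∥ Hy` for all `y` are linearly dependent — `H` invertible: `H⁻¹M` has every vector as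
an eigenvector, so `M = μH`; `rank H = 1`, `H = a·e⊗e`: `My ∥ e` on the dense set `e·y ≠ 0`, so `range M ⊆ ℝe` and by symmetry `M = m·e⊗e`;
`H = 0`: `(c₁,c₂) = (0,1)`.  Clebsch reading: `Hessₕσ(−1,0) = H − M` for `σ = v₂ − ∂_zφ`; Z1 says the Hessians of the two leaf functions
`w, σ` and the shear Jacobian are pairwise proportional at the thread.
PART B (iv) `det(H − M) ≥ 0` — NO X-POINT.  Extra hypotheses used: `N = v₂(−1,0) ≠ 0`, `√(−t)|v₂| ≤ |N|` (so `|w(·,0)| ≤ |N|` in the plane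
`z = 0` at `t = −1`), isolation of the horizontal critical point (`hiso`).  PROOF SKETCH: let `s := σ(−1,·,0)`, `f := v₂(−1,·,0)` on `ℝ²`
(Clebsch slice, tree `…Clebsch.exists_clebsch_slice`; `∇s = ∇ₕw − ∂_z vₕ`, so `∇s(0) = 0`, `Hess s(0) = H − M`).  If `det(H − M) < 0`, `0` is
a non-degenerate critical point of `s`, hence `∇s ≠ 0` on a punctured disc `D*`; `f` has a STRICT extremum at `0` (a point `y ≠ 0` near `0`
with `f(y) = N` would be a critical point, excluded by `hiso`); the frozen bracket `{s,f} ≡ 0` (tree `…Clebsch.frozen_bracket`) and `∇f ≠ 0` on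
`D*` give `∇s = λ∇f` with `λ` continuous and non-vanishing on the connected set `D*`, say `λ > 0` (WLOG `N > 0`).  Take `c` between
`max_{|y|=r} f` and `N` and let `U` be the component of `{f > c} ∩ D_r` containing `0` (`Ū ⊂ D_r` compact, `∂U ⊂ {f = c} ⊂ D*`).  `s|Ū`
attains its maximum at some `y*`; `y* ∈ U ∖ {0}` is impossible (`∇s(y*) ≠ 0`); `y* ∈ ∂U` is impossible (`∇f(y*) ≠ 0` and `{f > c}` near
`y*` is a connected half-neighbourhood contained in `U`, along `+∇f(y*)` into which `s` increases since `λ > 0`); so `y* = 0` and `s` has a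
local maximum at `0`: `Hess s(0) ≤ 0`, `det(H − M) ≥ 0` — contradiction.  (`λ < 0`: minimum, same conclusion.)  No periodic-orbit theory,
no analyticity; ingredients: Clebsch slice, frozen bracket, `C²` regularity of the slice (`…Clebsch.contDiff_slice`), components of open
sets, the submersion picture at a regular point, second-order condition at an extremum.  INSTRUMENT VALUE: (iv) is an INEQUALITY ROW at pin
threadI (`det(Hessₕv₂ − Dₕ∂_z vₕ)(0) ≥ 0`) not contained in the census ideal.
PART C (v) if `det(H − M) > 0` there is a `C²` potential `Φ` with `vₕ(−1,·) = ∇ₕΦ` (tree `…Clebsch.exists_clebsch_slice`, `Φ := φ ∈ C^∞`)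
such that `ψ := v₂(−1,·) − ∂_zΦ` has a STRICT planar local minimum or maximum at `0` in the plane `z = 0`, stated VERBATIM in the
`Filter.Eventually`/`nhdsWithin` form of the proved item `LoopPeriodRatchet.NoPlanarExtremum` (with `s = −1`, `y₀ = 0`).  PROOF SKETCH:
`∇ₕψ(0) = ∇ₕv₂(0) − ∂_z vₕ(0) = 0` (pins), `∂_a∂_bψ(0) = H_ab − ∂_b∂_z v_a(0) = (H − M)_ab` (symmetry of `D²φ`), `H − M` symmetric (part (i))
with positive determinant is definite; second-order sufficient condition for `ψ(·,0) ∈ C²` (Taylor along rays with a uniform remainder, or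
`Mathlib`'s `taylor_mean_remainder` on segments) gives the strict extremum on a punctured planar disc.
Why it might fail: it cannot as stated (formal consequence of the frozen
law at a double zero) — typing risk only (index conventions of `fderiv`); Lean size M (iterated `fderiv` of a product at a point). -/
theorem stub_threadZeroStructure :
    ∀ (C : ℝ) (v : ℝ → EuclideanSpace ℝ (Fin 3) → EuclideanSpace ℝ (Fin 3)),
      Literature.Analysis.FluidPDE.HasTypeITimeDecay C v →
      ContinuousOn (Function.uncurry v) (Set.Iio (0 : ℝ) ×ˢ Set.univ) →
      (∀ s t : ℝ, s < t → t < 0 → ∀ x, v t x =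
        Literature.Analysis.UnboundedOperators.heatExtension (v s) (t - s) x -
          Literature.Analysis.FluidPDE.oseenDuhamel 1 s v v t x) →
      (∀ t < 0, Literature.Analysis.FluidPDE.VectorCalculus.IsDivFree (v t)) →
      (∀ s < 0, ∀ y, ⟪Literature.Analysis.FluidPDE.curl (v s) y, EuclideanSpace.single 2 1⟫_ℝ = 0) →
      v (-1) 0 2 ≠ 0 → (∀ t < 0, ∀ x, Real.sqrt (-t) * |v t x 2| ≤ |v (-1) 0 2|) →
      (∀ h : EuclideanSpace ℝ (Fin 3), fderiv ℝ (v (-1)) 0 h 2 = 0) →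
      (∃ δ : ℝ, 0 < δ ∧ ∀ y : EuclideanSpace ℝ (Fin 3), y 2 = 0 → y ≠ 0 → ‖y‖ < δ →
          (fderiv ℝ (v (-1)) y (EuclideanSpace.single 0 1) 2 ≠ 0 ∨ fderiv ℝ (v (-1)) y (EuclideanSpace.single 1 1) 2 ≠ 0)) →
      (fderiv ℝ (v (-1)) 0 (EuclideanSpace.single 2 1) 0 = 0 ∧ fderiv ℝ (v (-1)) 0 (EuclideanSpace.single 2 1) 1 = 0) →
      (fderiv ℝ (fun x => fderiv ℝ (v (-1)) x (EuclideanSpace.single 2 1) 0) 0 (EuclideanSpace.single 1 1) =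
            fderiv ℝ (fun x => fderiv ℝ (v (-1)) x (EuclideanSpace.single 2 1) 1) 0 (EuclideanSpace.single 0 1) ∧
          fderiv ℝ (fun x => fderiv ℝ (v (-1)) x (EuclideanSpace.single 2 1) 0) 0 (EuclideanSpace.single 0 1) +
              fderiv ℝ (fun x => fderiv ℝ (v (-1)) x (EuclideanSpace.single 2 1) 1) 0 (EuclideanSpace.single 1 1) =
            -fderiv ℝ (fun x => fderiv ℝ (v (-1)) x (EuclideanSpace.single 2 1) 2) 0 (EuclideanSpace.single 2 1)) ∧
        ((∃ c₁ c₂ : ℝ, (c₁ ≠ 0 ∨ c₂ ≠ 0) ∧ ∀ a b : Fin 3, a ≠ 2 → b ≠ 2 →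
            c₁ * fderiv ℝ (fun x => fderiv ℝ (v (-1)) x (EuclideanSpace.single 2 1) a) 0 (EuclideanSpace.single b 1) =
              c₂ * fderiv ℝ (fun x => fderiv ℝ (v (-1)) x (EuclideanSpace.single a 1) 2) 0 (EuclideanSpace.single b 1))) ∧
        0 ≤ (fderiv ℝ (fun x => fderiv ℝ (v (-1)) x (EuclideanSpace.single 0 1) 2) 0 (EuclideanSpace.single 0 1) -
            fderiv ℝ (fun x => fderiv ℝ (v (-1)) x (EuclideanSpace.single 2 1) 0) 0 (EuclideanSpace.single 0 1)) *
          (fderiv ℝ (fun x => fderiv ℝ (v (-1)) x (EuclideanSpace.single 1 1) 2) 0 (EuclideanSpace.single 1 1) -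
            fderiv ℝ (fun x => fderiv ℝ (v (-1)) x (EuclideanSpace.single 2 1) 1) 0 (EuclideanSpace.single 1 1)) -
          (fderiv ℝ (fun x => fderiv ℝ (v (-1)) x (EuclideanSpace.single 0 1) 2) 0 (EuclideanSpace.single 1 1) -
            fderiv ℝ (fun x => fderiv ℝ (v (-1)) x (EuclideanSpace.single 2 1) 0) 0 (EuclideanSpace.single 1 1)) *
          (fderiv ℝ (fun x => fderiv ℝ (v (-1)) x (EuclideanSpace.single 1 1) 2) 0 (EuclideanSpace.single 0 1) -
            fderiv ℝ (fun x => fderiv ℝ (v (-1)) x (EuclideanSpace.single 2 1) 1) 0 (EuclideanSpace.single 0 1)) ∧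
        (0 < (fderiv ℝ (fun x => fderiv ℝ (v (-1)) x (EuclideanSpace.single 0 1) 2) 0 (EuclideanSpace.single 0 1) -
            fderiv ℝ (fun x => fderiv ℝ (v (-1)) x (EuclideanSpace.single 2 1) 0) 0 (EuclideanSpace.single 0 1)) *
          (fderiv ℝ (fun x => fderiv ℝ (v (-1)) x (EuclideanSpace.single 1 1) 2) 0 (EuclideanSpace.single 1 1) -
            fderiv ℝ (fun x => fderiv ℝ (v (-1)) x (EuclideanSpace.single 2 1) 1) 0 (EuclideanSpace.single 1 1)) -
          (fderiv ℝ (fun x => fderiv ℝ (v (-1)) x (EuclideanSpace.single 0 1) 2) 0 (EuclideanSpace.single 1 1) -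
            fderiv ℝ (fun x => fderiv ℝ (v (-1)) x (EuclideanSpace.single 2 1) 0) 0 (EuclideanSpace.single 1 1)) *
          (fderiv ℝ (fun x => fderiv ℝ (v (-1)) x (EuclideanSpace.single 1 1) 2) 0 (EuclideanSpace.single 0 1) -
            fderiv ℝ (fun x => fderiv ℝ (v (-1)) x (EuclideanSpace.single 2 1) 1) 0 (EuclideanSpace.single 0 1)) →
          ∃ Φ : EuclideanSpace ℝ (Fin 3) → ℝ, ContDiff ℝ 2 Φ ∧
            (∀ y, v (-1) y 0 = fderiv ℝ Φ y (EuclideanSpace.single 0 1) ∧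
              v (-1) y 1 = fderiv ℝ Φ y (EuclideanSpace.single 1 1)) ∧
            ((∀ᶠ y in nhdsWithin (0 : EuclideanSpace ℝ (Fin 3)) {y | y 2 = (0 : EuclideanSpace ℝ (Fin 3)) 2 ∧ y ≠ 0},
                v (-1) 0 2 - fderiv ℝ Φ 0 (EuclideanSpace.single 2 1) <
                  v (-1) y 2 - fderiv ℝ Φ y (EuclideanSpace.single 2 1)) ∨
              (∀ᶠ y in nhdsWithin (0 : EuclideanSpace ℝ (Fin 3)) {y | y 2 = (0 : EuclideanSpace ℝ (Fin 3)) 2 ∧ y ≠ 0},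
                v (-1) y 2 - fderiv ℝ Φ y (EuclideanSpace.single 2 1) <
                  v (-1) 0 2 - fderiv ℝ Φ 0 (EuclideanSpace.single 2 1)))) :=
  Summit.NavierStokesRegularity.NavierStokesRegularity.Theorems.PoloidalWindowDoorPoloidalWindowRigidityThreadZeroStructure.stub_threadZeroStructure

/-- **STUB S6G (THE NAMED WALL, shared BY NAME with route item stmt-NavierStokesRegularity-27893 and thread_axis v8–v10.2):
`LoopPeriodRatchet.FrequencyGrowthExponent`** — a non-stationary closed vortex line at time `t` with period `T` forces, at every earlier
time `t₀ ≤ t`, a non-stationary closed vortex line with period `≤ A·T·((−t₀)/(−t))^κ` for some `A > 0`, `κ < 3/2`.  With the PROVED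
`LoopPeriodRatchet.PeriodScalingBound` it yields, by the PROVED `noLoopsOfGrowth_proof`, that class poloidal profiles carry NO non-stationary
closed vortex line; with the PROVED `NoPlanarExtremum`, no strict planar extremum of the stream function.  OPEN; research; the wall is MET here
exactly as in thread_axis (same decl) — nothing about it is claimed.  Why it might fail: it is the standing wall of the loop world (I8a/I9:
off symmetry the period ratchet is dead; I8c: boundedness is load-bearing). -/
theorem stub_frequencyGrowthExponent :
    Summit.NavierStokesRegularity.NavierStokesRegularity.Theses.LoopPeriodRatchet.FrequencyGrowthExponent := by
  sorry

/-- **THEOREM (v3's deciding stub Z2, now kernel-checked modulo S6G): NO ISOLATED THREAD AT A VORTEX CENTRE.**  `stub_isolatedThreadEmpty`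
(isolated_thread v1) VERBATIM, plus the loop-tangency pins, plus `det(H − M) > 0`, Z1's dependence and symmetry/trace: `False`.  Proof:
Z1(C) gives the Clebsch potential and a strict planar extremum of `ψ = v₂ − ∂_zΦ` at the thread; `noLoopsOfGrowth_proof S6G periodScalingBound_proof`
is the no-closed-vortex-lines property of the profile; `noPlanarExtremum_proof` forbids the strict extremum.  (With the sign pins `H ≤ 0`,
`tr M ≥ 0`, `det(H − M) > 0` iff `H − M` is negative definite: the Morse tops `M = μH`, `μ ≤ 0`, AND the flat tops `H = 0` over a positive
definite shear — thread_type's singular-slope object C3 — are all in this cell.) -/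
theorem centreThreadEmpty_of_growth :
    ∀ (C : ℝ) (v : ℝ → EuclideanSpace ℝ (Fin 3) → EuclideanSpace ℝ (Fin 3)),
      Literature.Analysis.FluidPDE.HasTypeITimeDecay C v →
      ContinuousOn (Function.uncurry v) (Set.Iio (0 : ℝ) ×ˢ Set.univ) →
      (∀ s t : ℝ, s < t → t < 0 → ∀ x, v t x =
        Literature.Analysis.UnboundedOperators.heatExtension (v s) (t - s) x -
          Literature.Analysis.FluidPDE.oseenDuhamel 1 s v v t x) →
      (∀ t < 0, Literature.Analysis.FluidPDE.VectorCalculus.IsDivFree (v t)) →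
      (∀ s < 0, ∀ y, ⟪Literature.Analysis.FluidPDE.curl (v s) y, EuclideanSpace.single 2 1⟫_ℝ = 0) →
      v (-1) 0 2 ≠ 0 → (∀ t < 0, ∀ x, Real.sqrt (-t) * |v t x 2| ≤ |v (-1) 0 2|) →
      (∀ h : EuclideanSpace ℝ (Fin 3), fderiv ℝ (v (-1)) 0 h 2 = 0) →
      (deriv (fun s => v s 0 2) (-1) = v (-1) 0 2 / 2 ∧ v (-1) 0 2 * (Δ (fun y => v (-1) y 2)) 0 ≤ 0) →
      (∃ δ : ℝ, 0 < δ ∧ ∀ y : EuclideanSpace ℝ (Fin 3), y 2 = 0 → y ≠ 0 → ‖y‖ < δ →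
          (fderiv ℝ (v (-1)) y (EuclideanSpace.single 0 1) 2 ≠ 0 ∨ fderiv ℝ (v (-1)) y (EuclideanSpace.single 1 1) 2 ≠ 0)) →
      ∀ W : Set (ℝ × EuclideanSpace ℝ (Fin 3)), IsOpen W → W ⊆ Set.Iio (0 : ℝ) ×ˢ Set.univ →
        (∀ z ∈ W, (Literature.Analysis.FluidPDE.curl (v z.1) z.2 ≠ 0 ∧
            (fderiv ℝ (v z.1) z.2 (EuclideanSpace.single 0 1) 2 ≠ 0 ∨ fderiv ℝ (v z.1) z.2 (EuclideanSpace.single 1 1) 2 ≠ 0) ∧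
            (fderiv ℝ (v z.1) z.2 (EuclideanSpace.single 2 1) 0 ≠ 0 ∨ fderiv ℝ (v z.1) z.2 (EuclideanSpace.single 2 1) 1 ≠ 0)) ∧
          (fderiv ℝ (fun x => fderiv ℝ (v z.1) x (EuclideanSpace.single 2 1) 2) z.2 (EuclideanSpace.single 0 1) *
                fderiv ℝ (v z.1) z.2 (EuclideanSpace.single 1 1) 2 -
              fderiv ℝ (fun x => fderiv ℝ (v z.1) x (EuclideanSpace.single 2 1) 2) z.2 (EuclideanSpace.single 1 1) *
                fderiv ℝ (v z.1) z.2 (EuclideanSpace.single 0 1) 2 ≠ 0)) →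
        (∀ m : ℝ → ℝ → ℝ, ∀ W₁ : Set (ℝ × EuclideanSpace ℝ (Fin 3)), W₁ ⊆ W → IsOpen W₁ → W₁.Nonempty →
            ∃ z ∈ W₁, ∃ b : Fin 3, b ≠ 2 ∧
              fderiv ℝ (v z.1) z.2 (EuclideanSpace.single 2 1) b ≠
                m z.1 (z.2 2) * fderiv ℝ (v z.1) z.2 (EuclideanSpace.single b 1) 2) →
        (∀ r : ℝ, 0 < r → (Metric.ball ((-1 : ℝ), (0 : EuclideanSpace ℝ (Fin 3))) r ∩ W).Nonempty) →
        (fderiv ℝ (v (-1)) 0 (EuclideanSpace.single 2 1) 0 = 0 ∧ fderiv ℝ (v (-1)) 0 (EuclideanSpace.single 2 1) 1 = 0) →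
        0 < (fderiv ℝ (fun x => fderiv ℝ (v (-1)) x (EuclideanSpace.single 0 1) 2) 0 (EuclideanSpace.single 0 1) -
            fderiv ℝ (fun x => fderiv ℝ (v (-1)) x (EuclideanSpace.single 2 1) 0) 0 (EuclideanSpace.single 0 1)) *
          (fderiv ℝ (fun x => fderiv ℝ (v (-1)) x (EuclideanSpace.single 1 1) 2) 0 (EuclideanSpace.single 1 1) -
            fderiv ℝ (fun x => fderiv ℝ (v (-1)) x (EuclideanSpace.single 2 1) 1) 0 (EuclideanSpace.single 1 1)) -
          (fderiv ℝ (fun x => fderiv ℝ (v (-1)) x (EuclideanSpace.single 0 1) 2) 0 (EuclideanSpace.single 1 1) -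
            fderiv ℝ (fun x => fderiv ℝ (v (-1)) x (EuclideanSpace.single 2 1) 0) 0 (EuclideanSpace.single 1 1)) *
          (fderiv ℝ (fun x => fderiv ℝ (v (-1)) x (EuclideanSpace.single 1 1) 2) 0 (EuclideanSpace.single 0 1) -
            fderiv ℝ (fun x => fderiv ℝ (v (-1)) x (EuclideanSpace.single 2 1) 1) 0 (EuclideanSpace.single 0 1)) →
        (∃ c₁ c₂ : ℝ, (c₁ ≠ 0 ∨ c₂ ≠ 0) ∧ ∀ a b : Fin 3, a ≠ 2 → b ≠ 2 →
            c₁ * fderiv ℝ (fun x => fderiv ℝ (v (-1)) x (EuclideanSpace.single 2 1) a) 0 (EuclideanSpace.single b 1) =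
              c₂ * fderiv ℝ (fun x => fderiv ℝ (v (-1)) x (EuclideanSpace.single a 1) 2) 0 (EuclideanSpace.single b 1)) →
        (fderiv ℝ (fun x => fderiv ℝ (v (-1)) x (EuclideanSpace.single 2 1) 0) 0 (EuclideanSpace.single 1 1) =
            fderiv ℝ (fun x => fderiv ℝ (v (-1)) x (EuclideanSpace.single 2 1) 1) 0 (EuclideanSpace.single 0 1) ∧
          fderiv ℝ (fun x => fderiv ℝ (v (-1)) x (EuclideanSpace.single 2 1) 0) 0 (EuclideanSpace.single 0 1) +
              fderiv ℝ (fun x => fderiv ℝ (v (-1)) x (EuclideanSpace.single 2 1) 1) 0 (EuclideanSpace.single 1 1) =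
            -fderiv ℝ (fun x => fderiv ℝ (v (-1)) x (EuclideanSpace.single 2 1) 2) 0 (EuclideanSpace.single 2 1)) →
        False := by
  intro C v hrate hcont hmild hdiv hpol hV hsup hgrad hpins hiso W hWo hWs hW hnTH hacc hpin hdet hdep hsym
  obtain ⟨-, -, -, hC⟩ := stub_threadZeroStructure C v hrate hcont hmild hdiv hpol hV hsup hgrad hiso hpin
  obtain ⟨Φ, hΦ, hvΦ, hext⟩ := hC hdet
  have hNL :=
    Summit.NavierStokesRegularity.NavierStokesRegularity.Theorems.LoopPeriodRatchetNoLoopsOfGrowth.noLoopsOfGrowth_proof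
      stub_frequencyGrowthExponent
      Summit.NavierStokesRegularity.NavierStokesRegularity.Theorems.LoopPeriodRatchetPeriodScalingBound.periodScalingBound_proof
      C v hrate hcont hmild hdiv hpol
  have hNPE :=
    Summit.NavierStokesRegularity.NavierStokesRegularity.Theorems.LoopPeriodRatchetNoPlanarExtremum.noPlanarExtremum_proof
      C v hrate hcont hmild hdiv hpol hNL (-1) (by norm_num) Φ hΦ hvΦ 0
  rcases hext with hmin | hmax
  · exact hNPE.1 hmin
  · exact hNPE.2 hmax

/-- **STUB Z3 (residue on a NEW typed object): NO LINE-JET ISOLATED THREAD.**  `stub_isolatedThreadEmpty` VERBATIM, plus the loop-tangency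
pins, plus: `det(H − M) = 0` (the vorticity zero at the thread is DEGENERATE), with Z1's symmetry, trace and dependence.  STRUCTURE (provable
from the hypotheses + the maximum's sign pins `H ≤ 0`, `tr M = −∂_z²v₂(−1,0) ≥ 0`, left to the prover): `c₁M = c₂H` and `det(H − M) = 0` force
`H`, `M`, `H − M` to be multiples of ONE rank-one tensor `f⊗f`, `f` horizontal (`M = H ≠ 0` would need `tr H = tr M`, i.e. `tr H = 0 = H`): the
2-jet of `(∇ₕv₂, ∂_z vₕ, ωₕ)` at `(−1,0)` is invariant under translations along `f^⊥` — to second order the thread is a LINE of hot spots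
(infinitesimal stratum (A); the cell contains the parabolic tops `H = −a f⊗f`, `M = μH`, and the totally flat 2-jet `H = M = 0`).  Named
neighbour theorem: STRATUM-A-K2p4 THEOREM A-THICK (no thick twisting member with an exact horizontal translation symmetry); candidate transfer
(NOT claimed): the anisotropic blow-up along `f^⊥` at the thread produces a stratum-(A) tangent object for which A-THICK's mechanism would have
to be re-proved with error terms.  Extra unsteady pins available on this cell (unused by every census so far): for a flat direction `u ∈ f^⊥`,
the space-time Hessian of `√(−t)·v₂` at its maximum `(−1,0)` is `≤ 0` with `∂_u²v₂ = 0`, which forces the mixed entries `∂_t∂_u v₂(−1,0) = 0`,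
`∂_u∂_z v₂ = ∂_u∂_f v₂ = 0`, and `∂_u³v₂ = 0`, `∂_u⁴v₂ ≤ 0`.  From Z1 part B's argument on this cell: either zeros of `ωₕ(−1,·,0)` (`Λ = 1` points) accumulate at the thread, or `σ(·,0)` has an isolated DEGENERATE local extremum at `0` (for the prover; not a hypothesis).  Why it might fail: degenerate configurations are compatible with every finite jet
once the structure rows are imposed unless the threadI sub-census says otherwise; class-level only; it is a residue — no mechanism claimed. -/
theorem stub_lineJetThreadEmpty :
    ∀ (C : ℝ) (v : ℝ → EuclideanSpace ℝ (Fin 3) → EuclideanSpace ℝ (Fin 3)),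
      Literature.Analysis.FluidPDE.HasTypeITimeDecay C v →
      ContinuousOn (Function.uncurry v) (Set.Iio (0 : ℝ) ×ˢ Set.univ) →
      (∀ s t : ℝ, s < t → t < 0 → ∀ x, v t x =
        Literature.Analysis.UnboundedOperators.heatExtension (v s) (t - s) x -
          Literature.Analysis.FluidPDE.oseenDuhamel 1 s v v t x) →
      (∀ t < 0, Literature.Analysis.FluidPDE.VectorCalculus.IsDivFree (v t)) →
      (∀ s < 0, ∀ y, ⟪Literature.Analysis.FluidPDE.curl (v s) y, EuclideanSpace.single 2 1⟫_ℝ = 0) →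
      v (-1) 0 2 ≠ 0 → (∀ t < 0, ∀ x, Real.sqrt (-t) * |v t x 2| ≤ |v (-1) 0 2|) →
      (∀ h : EuclideanSpace ℝ (Fin 3), fderiv ℝ (v (-1)) 0 h 2 = 0) →
      (deriv (fun s => v s 0 2) (-1) = v (-1) 0 2 / 2 ∧ v (-1) 0 2 * (Δ (fun y => v (-1) y 2)) 0 ≤ 0) →
      (∃ δ : ℝ, 0 < δ ∧ ∀ y : EuclideanSpace ℝ (Fin 3), y 2 = 0 → y ≠ 0 → ‖y‖ < δ →
          (fderiv ℝ (v (-1)) y (EuclideanSpace.single 0 1) 2 ≠ 0 ∨ fderiv ℝ (v (-1)) y (EuclideanSpace.single 1 1) 2 ≠ 0)) →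
      ∀ W : Set (ℝ × EuclideanSpace ℝ (Fin 3)), IsOpen W → W ⊆ Set.Iio (0 : ℝ) ×ˢ Set.univ →
        (∀ z ∈ W, (Literature.Analysis.FluidPDE.curl (v z.1) z.2 ≠ 0 ∧
            (fderiv ℝ (v z.1) z.2 (EuclideanSpace.single 0 1) 2 ≠ 0 ∨ fderiv ℝ (v z.1) z.2 (EuclideanSpace.single 1 1) 2 ≠ 0) ∧
            (fderiv ℝ (v z.1) z.2 (EuclideanSpace.single 2 1) 0 ≠ 0 ∨ fderiv ℝ (v z.1) z.2 (EuclideanSpace.single 2 1) 1 ≠ 0)) ∧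
          (fderiv ℝ (fun x => fderiv ℝ (v z.1) x (EuclideanSpace.single 2 1) 2) z.2 (EuclideanSpace.single 0 1) *
                fderiv ℝ (v z.1) z.2 (EuclideanSpace.single 1 1) 2 -
              fderiv ℝ (fun x => fderiv ℝ (v z.1) x (EuclideanSpace.single 2 1) 2) z.2 (EuclideanSpace.single 1 1) *
                fderiv ℝ (v z.1) z.2 (EuclideanSpace.single 0 1) 2 ≠ 0)) →
        (∀ m : ℝ → ℝ → ℝ, ∀ W₁ : Set (ℝ × EuclideanSpace ℝ (Fin 3)), W₁ ⊆ W → IsOpen W₁ → W₁.Nonempty →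
            ∃ z ∈ W₁, ∃ b : Fin 3, b ≠ 2 ∧
              fderiv ℝ (v z.1) z.2 (EuclideanSpace.single 2 1) b ≠
                m z.1 (z.2 2) * fderiv ℝ (v z.1) z.2 (EuclideanSpace.single b 1) 2) →
        (∀ r : ℝ, 0 < r → (Metric.ball ((-1 : ℝ), (0 : EuclideanSpace ℝ (Fin 3))) r ∩ W).Nonempty) →
        (fderiv ℝ (v (-1)) 0 (EuclideanSpace.single 2 1) 0 = 0 ∧ fderiv ℝ (v (-1)) 0 (EuclideanSpace.single 2 1) 1 = 0) →
        (fderiv ℝ (fun x => fderiv ℝ (v (-1)) x (EuclideanSpace.single 0 1) 2) 0 (EuclideanSpace.single 0 1) -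
            fderiv ℝ (fun x => fderiv ℝ (v (-1)) x (EuclideanSpace.single 2 1) 0) 0 (EuclideanSpace.single 0 1)) *
          (fderiv ℝ (fun x => fderiv ℝ (v (-1)) x (EuclideanSpace.single 1 1) 2) 0 (EuclideanSpace.single 1 1) -
            fderiv ℝ (fun x => fderiv ℝ (v (-1)) x (EuclideanSpace.single 2 1) 1) 0 (EuclideanSpace.single 1 1)) -
          (fderiv ℝ (fun x => fderiv ℝ (v (-1)) x (EuclideanSpace.single 0 1) 2) 0 (EuclideanSpace.single 1 1) -
            fderiv ℝ (fun x => fderiv ℝ (v (-1)) x (EuclideanSpace.single 2 1) 0) 0 (EuclideanSpace.single 1 1)) *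
          (fderiv ℝ (fun x => fderiv ℝ (v (-1)) x (EuclideanSpace.single 1 1) 2) 0 (EuclideanSpace.single 0 1) -
            fderiv ℝ (fun x => fderiv ℝ (v (-1)) x (EuclideanSpace.single 2 1) 1) 0 (EuclideanSpace.single 0 1)) = 0 →
        (∃ c₁ c₂ : ℝ, (c₁ ≠ 0 ∨ c₂ ≠ 0) ∧ ∀ a b : Fin 3, a ≠ 2 → b ≠ 2 →
            c₁ * fderiv ℝ (fun x => fderiv ℝ (v (-1)) x (EuclideanSpace.single 2 1) a) 0 (EuclideanSpace.single b 1) =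
              c₂ * fderiv ℝ (fun x => fderiv ℝ (v (-1)) x (EuclideanSpace.single a 1) 2) 0 (EuclideanSpace.single b 1)) →
        (fderiv ℝ (fun x => fderiv ℝ (v (-1)) x (EuclideanSpace.single 2 1) 0) 0 (EuclideanSpace.single 1 1) =
            fderiv ℝ (fun x => fderiv ℝ (v (-1)) x (EuclideanSpace.single 2 1) 1) 0 (EuclideanSpace.single 0 1) ∧
          fderiv ℝ (fun x => fderiv ℝ (v (-1)) x (EuclideanSpace.single 2 1) 0) 0 (EuclideanSpace.single 0 1) +
              fderiv ℝ (fun x => fderiv ℝ (v (-1)) x (EuclideanSpace.single 2 1) 1) 0 (EuclideanSpace.single 1 1) =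
            -fderiv ℝ (fun x => fderiv ℝ (v (-1)) x (EuclideanSpace.single 2 1) 2) 0 (EuclideanSpace.single 2 1)) →
        False := by
  sorry

/-! ## Compositions (kernel-checked; no `sorry` below this line) -/

/-- **I2 `stub_isolatedThreadEmpty` (isolated_thread v1 b7fc49e2120c, VERBATIM statement) from P1, Z1, `centreThreadEmpty_of_growth` (S6G) and Z3: Z1 gives
`0 ≤ det(H − M)`; `0 < det` is Z2 (centre), `det = 0` is Z3 (line-jet) (v3 cut).** -/
theorem isolatedThreadEmpty_of_centreType :
    ∀ (C : ℝ) (v : ℝ → EuclideanSpace ℝ (Fin 3) → EuclideanSpace ℝ (Fin 3)),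
      Literature.Analysis.FluidPDE.HasTypeITimeDecay C v →
      ContinuousOn (Function.uncurry v) (Set.Iio (0 : ℝ) ×ˢ Set.univ) →
      (∀ s t : ℝ, s < t → t < 0 → ∀ x, v t x =
        Literature.Analysis.UnboundedOperators.heatExtension (v s) (t - s) x -
          Literature.Analysis.FluidPDE.oseenDuhamel 1 s v v t x) →
      (∀ t < 0, Literature.Analysis.FluidPDE.VectorCalculus.IsDivFree (v t)) →
      (∀ s < 0, ∀ y, ⟪Literature.Analysis.FluidPDE.curl (v s) y, EuclideanSpace.single 2 1⟫_ℝ = 0) →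
      v (-1) 0 2 ≠ 0 → (∀ t < 0, ∀ x, Real.sqrt (-t) * |v t x 2| ≤ |v (-1) 0 2|) →
      (∀ h : EuclideanSpace ℝ (Fin 3), fderiv ℝ (v (-1)) 0 h 2 = 0) →
      (deriv (fun s => v s 0 2) (-1) = v (-1) 0 2 / 2 ∧ v (-1) 0 2 * (Δ (fun y => v (-1) y 2)) 0 ≤ 0) →
      (∃ δ : ℝ, 0 < δ ∧ ∀ y : EuclideanSpace ℝ (Fin 3), y 2 = 0 → y ≠ 0 → ‖y‖ < δ →
          (fderiv ℝ (v (-1)) y (EuclideanSpace.single 0 1) 2 ≠ 0 ∨ fderiv ℝ (v (-1)) y (EuclideanSpace.single 1 1) 2 ≠ 0)) →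
      ∀ W : Set (ℝ × EuclideanSpace ℝ (Fin 3)), IsOpen W → W ⊆ Set.Iio (0 : ℝ) ×ˢ Set.univ →
        (∀ z ∈ W, (Literature.Analysis.FluidPDE.curl (v z.1) z.2 ≠ 0 ∧
            (fderiv ℝ (v z.1) z.2 (EuclideanSpace.single 0 1) 2 ≠ 0 ∨ fderiv ℝ (v z.1) z.2 (EuclideanSpace.single 1 1) 2 ≠ 0) ∧
            (fderiv ℝ (v z.1) z.2 (EuclideanSpace.single 2 1) 0 ≠ 0 ∨ fderiv ℝ (v z.1) z.2 (EuclideanSpace.single 2 1) 1 ≠ 0)) ∧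
          (fderiv ℝ (fun x => fderiv ℝ (v z.1) x (EuclideanSpace.single 2 1) 2) z.2 (EuclideanSpace.single 0 1) *
                fderiv ℝ (v z.1) z.2 (EuclideanSpace.single 1 1) 2 -
              fderiv ℝ (fun x => fderiv ℝ (v z.1) x (EuclideanSpace.single 2 1) 2) z.2 (EuclideanSpace.single 1 1) *
                fderiv ℝ (v z.1) z.2 (EuclideanSpace.single 0 1) 2 ≠ 0)) →
        (∀ m : ℝ → ℝ → ℝ, ∀ W₁ : Set (ℝ × EuclideanSpace ℝ (Fin 3)), W₁ ⊆ W → IsOpen W₁ → W₁.Nonempty →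
            ∃ z ∈ W₁, ∃ b : Fin 3, b ≠ 2 ∧
              fderiv ℝ (v z.1) z.2 (EuclideanSpace.single 2 1) b ≠
                m z.1 (z.2 2) * fderiv ℝ (v z.1) z.2 (EuclideanSpace.single b 1) 2) →
        (∀ r : ℝ, 0 < r → (Metric.ball ((-1 : ℝ), (0 : EuclideanSpace ℝ (Fin 3))) r ∩ W).Nonempty) →
        False := by
  intro C v hrate hcont hmild hdiv hpol hV hsup hgrad hpins hiso W hWo hWs hW hnTH hacc
  have hpin := stub_loopTangencyPin C v hrate hcont hmild hdiv hpol hV hsup hiso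
  obtain ⟨hsym, hdep, hdet0, -⟩ := stub_threadZeroStructure C v hrate hcont hmild hdiv hpol hV hsup hgrad hiso hpin
  rcases hdet0.lt_or_eq with hdet | hdet
  · exact centreThreadEmpty_of_growth C v hrate hcont hmild hdiv hpol hV hsup hgrad hpins hiso W hWo hWs hW hnTH hacc hpin hdet hdep hsym
  · exact stub_lineJetThreadEmpty C v hrate hcont hmild hdiv hpol hV hsup hgrad hpins hiso W hWo hWs hW hnTH hacc hpin hdet.symm hdep hsym

/-- **S3 `stub_threadedThickEmpty` (twist_split v5 / far_thread v4, VERBATIM statement) from I1, the composed I2 and I3.** -/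
theorem threadedThickEmpty_of_centreType :
    ∀ (C : ℝ) (v : ℝ → EuclideanSpace ℝ (Fin 3) → EuclideanSpace ℝ (Fin 3)),
      Literature.Analysis.FluidPDE.HasTypeITimeDecay C v →
      ContinuousOn (Function.uncurry v) (Set.Iio (0 : ℝ) ×ˢ Set.univ) →
      (∀ s t : ℝ, s < t → t < 0 → ∀ x, v t x =
        Literature.Analysis.UnboundedOperators.heatExtension (v s) (t - s) x -
          Literature.Analysis.FluidPDE.oseenDuhamel 1 s v v t x) →
      (∀ t < 0, Literature.Analysis.FluidPDE.VectorCalculus.IsDivFree (v t)) →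
      (∀ s < 0, ∀ y, ⟪Literature.Analysis.FluidPDE.curl (v s) y, EuclideanSpace.single 2 1⟫_ℝ = 0) →
      v (-1) 0 2 ≠ 0 → (∀ t < 0, ∀ x, Real.sqrt (-t) * |v t x 2| ≤ |v (-1) 0 2|) →
      (∀ h : EuclideanSpace ℝ (Fin 3), fderiv ℝ (v (-1)) 0 h 2 = 0) →
      (deriv (fun s => v s 0 2) (-1) = v (-1) 0 2 / 2 ∧ v (-1) 0 2 * (Δ (fun y => v (-1) y 2)) 0 ≤ 0) →
      ∀ W : Set (ℝ × EuclideanSpace ℝ (Fin 3)), IsOpen W → W ⊆ Set.Iio (0 : ℝ) ×ˢ Set.univ →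
        (∀ z ∈ W, (Literature.Analysis.FluidPDE.curl (v z.1) z.2 ≠ 0 ∧
            (fderiv ℝ (v z.1) z.2 (EuclideanSpace.single 0 1) 2 ≠ 0 ∨ fderiv ℝ (v z.1) z.2 (EuclideanSpace.single 1 1) 2 ≠ 0) ∧
            (fderiv ℝ (v z.1) z.2 (EuclideanSpace.single 2 1) 0 ≠ 0 ∨ fderiv ℝ (v z.1) z.2 (EuclideanSpace.single 2 1) 1 ≠ 0)) ∧
          (fderiv ℝ (fun x => fderiv ℝ (v z.1) x (EuclideanSpace.single 2 1) 2) z.2 (EuclideanSpace.single 0 1) *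
                fderiv ℝ (v z.1) z.2 (EuclideanSpace.single 1 1) 2 -
              fderiv ℝ (fun x => fderiv ℝ (v z.1) x (EuclideanSpace.single 2 1) 2) z.2 (EuclideanSpace.single 1 1) *
                fderiv ℝ (v z.1) z.2 (EuclideanSpace.single 0 1) 2 ≠ 0)) →
        (∀ m : ℝ → ℝ → ℝ, ∀ W₁ : Set (ℝ × EuclideanSpace ℝ (Fin 3)), W₁ ⊆ W → IsOpen W₁ → W₁.Nonempty →
            ∃ z ∈ W₁, ∃ b : Fin 3, b ≠ 2 ∧
              fderiv ℝ (v z.1) z.2 (EuclideanSpace.single 2 1) b ≠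
                m z.1 (z.2 2) * fderiv ℝ (v z.1) z.2 (EuclideanSpace.single b 1) 2) →
        (∀ r : ℝ, 0 < r → (Metric.ball ((-1 : ℝ), (0 : EuclideanSpace ℝ (Fin 3))) r ∩ W).Nonempty) →
        False := by
  intro C v hrate hcont hmild hdiv hpol hV hsup hgrad hpins W hWo hWs hW hnTH hacc
  rcases stub_threadCurveSelection C v hrate hcont hmild hdiv hpol hV hsup with hiso | harc
  · exact isolatedThreadEmpty_of_centreType C v hrate hcont hmild hdiv hpol hV hsup hgrad hpins hiso W hWo hWs hW hnTH hacc
  · exact stub_hotArcEmpty C v hrate hcont hmild hdiv hpol hV hsup hgrad hpins harc W hWo hWs hW hnTH hacc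

/-- **The item `LrcModEntire` (stmt-NavierStokesRegularity-20428) BY NAME** — tree p633507 `…FarThreadReduction.lrcModEntire_of_NUGRS_of_threadedThick`. -/
theorem LrcModEntire_of_centreType :
    Summit.NavierStokesRegularity.NavierStokesRegularity.Theses.PoloidalWindowDoor.LrcModEntire :=
  lrcModEntire_of_NUGRS_of_threadedThick stub_localTHEmptyHypNUGRS threadedThickEmpty_of_centreType

/-- **The crux `PoloidalWindowRigidity` (K2, stmt-NavierStokesRegularity-19708) BY NAME** — tree `…FarThreadReduction.poloidalWindowRigidity_of_TH_of_threadedThick`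
with the (TH)∩twisting germ statement from the shared v4.3 local stub through the tree chain, and the composed S3. -/
theorem PoloidalWindowRigidity_of_centreType :
    Summit.NavierStokesRegularity.NavierStokesRegularity.Theses.PoloidalWindowDoor.PoloidalWindowRigidity :=
  poloidalWindowRigidity_of_TH_of_threadedThick
    (stub_twistingTH_of_localEmptyHyp
      (localTHEmptyHyp_of_localTHEmptyHypNonUmbilic
        (localTHEmptyHypNonUmbilic_of_galilean (localTHEmptyHypNF_of_normalFormRS stub_localTHEmptyHypNUGRS))))
    threadedThickEmpty_of_centreType

end Summit.NavierStokesRegularity.NavierStokesRegularity.Cruxes.PoloidalWindowRigidity.CentreType
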